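import Summits.CriticalPhenomena.PercolationContinuityZ3.Theorems.Transplant.SiteCSHTheoremOne
import Summits.CriticalPhenomena.PercolationContinuityZ3.Theorems.Transplant.SiteKNTools
import Literature.Probability.Percolation.KozmaNitzanPinning
import HarnessLib

/-!
# SITE Kozma–Nitzan §4, input: site Conjecture 3 over every finite vertex type, for finitely supported vertex
# weightings of a countable graph, and with a target SET (site twin of the `Transfer` section of
# `L/KozmaNitzanPinning.lean`: `KozmaNitzan2024_conjecture3.fintype / .finSupp / .openConn_set`)

builds on p205010 (kernel theorem, internal audit signed; external expert review pending).
Lane `prim-bschramm`, class C1a (site percolation on `ℤ³`), seat p1 gen 3, block (α1) of the SITE same-`p` witness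
(`SiteSameP.SiteSamePWitnessZd`, socket p217536).  Helper file (`--supports stmt-CriticalPhenomena-4575`).

The site finite leg gives SITE KN Conjecture 3 as typed, over `Fin n` (`SiteCSH.siteNearOneGluing_holds`, p215077):
`∀ ε ∃ δ`, for every finite graph `G : SimpleGraph (Fin n)`, vertex weights `q`, relay set `A`, `o`, `b`:
`P(o ↔ A) > 1 − δ ∧ (∀ a ∈ A, P(a ↔ b) > 1 − δ) ⇒ P(o ↔ b) > 1 − ε` (`P = prodBernoulli q`, `↔` = `SiteTransplant.siteConn G`).
The site target lemma (KN Lemma 10, Step V) consumes it for finitely supported vertex weightings of `ℤ^d` with a target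
SET `T`.  This file performs the three transfers, never leaving the class of product measures on vertex configurations:

* `siteGluing_fintype` — over every finite vertex type (relabelling along `Fintype.equivFin`, pull-back coupling
  `prodBernoulli_map_preimage`);
* `siteGluing_finSupp` — over every countable vertex type for weights vanishing off a finite set `S` (restriction to
  the induced graph on `S`, on which the configuration a.s. lives);
* `siteGluing_set` — with a finite target SET `T`: the bond proof wires `T` to a point; for SITE percolation the
  same effect is obtained by an APEX vertex of weight `1` adjacent to exactly the vertices of `T` (`apexGraph`), i.e. by
  changing the graph, which site Conjecture 3 allows; `siteGluing_avoiding` — the weaker form in which the relays are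
  only assumed reliable to `T` INSIDE a region (`siteConnIn`), the shape of the hypothesis `hC` of the bond
  `KozmaNitzan.targetLemma_avoiding`.
Tools (pull-back coupling, measurability of `siteConn`, the apex graph) are in `SiteKNTools.lean`.
[cite: KozmaNitzan2024, Conjecture 3 (p. 15); §4 p. 22 ("we identified the set T to a point")] [cite: GrimmettPercolation1999, §1.6]
-/

noncomputable section

namespace Summit.CriticalPhenomena.PercolationContinuityZ3.Theorems.Transplant

namespace SiteKN

open MeasureTheory ProbabilityTheory
open Literature.Probability.Percolation Literature.Probability.LatticeModels
open SiteTransplant (siteConn mem_siteConn)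
/-! ## Site Conjecture 3 over every finite vertex type -/

/-- **Site Conjecture 3 holds over every finite vertex type** (from the `Fin n` theorem `SiteCSH.siteNearOneGluing_holds`):
relabel along `Fintype.equivFin`. [cite: KozmaNitzan2024, Conjecture 3 (p. 15)] -/
theorem siteGluing_fintype {ε : ℝ} (hε : 0 < ε) :
    ∃ δ : ℝ, 0 < δ ∧ ∀ (V : Type) [Fintype V] [DecidableEq V] (G : SimpleGraph V) (q : V → unitInterval)
      (A : Finset V) (o b : V),
      1 - δ < (prodBernoulli q).real (⋃ a ∈ A, siteConn G o a) →
        (∀ a ∈ A, 1 - δ < (prodBernoulli q).real (siteConn G a b)) →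
          1 - ε < (prodBernoulli q).real (siteConn G o b) := by
  obtain ⟨δ, hδ, h⟩ := SiteCSH.siteNearOneGluing_holds ε hε
  refine ⟨δ, hδ, fun V _ _ G q A o b hoA hab => ?_⟩
  classical
  set e := Fintype.equivFin V with he
  set n := Fintype.card V
  set G' : SimpleGraph (Fin n) := G.comap e.symm with hG'
  set q' : Fin n → unitInterval := fun i => q (e.symm i) with hq'
  set π : Set V → Set (Fin n) := fun ω => e.symm ⁻¹' ω with hπ
  have hmap : (prodBernoulli q).map π = prodBernoulli q' := prodBernoulli_map_preimage q e.symm.injective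
  have hmeas : ∀ C : Set (Set (Fin n)), MeasurableSet C := fun _ => MeasurableSet.of_discrete
  -- the graph isomorphism on open graphs
  have hiff : ∀ (ω : Set V) (x y : V), π ω ∈ siteConn G' (e x) (e y) ↔ ω ∈ siteConn G x y := by
    intro ω x y
    -- homs in both directions
    let φ : siteOpenGraph G ω →g siteOpenGraph G' (π ω) :=
      { toFun := e
        map_rel' := fun {a c} hac => by
          rw [siteOpenGraph_adj] at hac ⊢
          simp only [hG', SimpleGraph.comap_adj, Equiv.symm_apply_apply, hπ, Set.mem_preimage]
          exact hac }
    let ψ : siteOpenGraph G' (π ω) →g siteOpenGraph G ω :=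
      { toFun := e.symm
        map_rel' := fun {a c} hac => by
          rw [siteOpenGraph_adj] at hac ⊢
          simp only [hG', SimpleGraph.comap_adj, hπ, Set.mem_preimage] at hac
          exact hac }
    constructor
    · rintro ⟨hx, hy, hr⟩
      refine ⟨by simpa [hπ] using hx, by simpa [hπ] using hy, ?_⟩
      have := hr.map ψ
      simpa [ψ] using this
    · rintro ⟨hx, hy, hr⟩
      exact ⟨by simpa [hπ] using hx, by simpa [hπ] using hy, hr.map φ⟩
  have key : ∀ x y : V, (prodBernoulli q').real (siteConn G' (e x) (e y)) = (prodBernoulli q).real (siteConn G x y) := by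
    intro x y
    rw [← hmap, map_measureReal_apply (measurable_preimage_config _) (hmeas _)]
    congr 1; ext ω; exact hiff ω x y
  have keyU : (prodBernoulli q').real (⋃ a ∈ A.map e.toEmbedding, siteConn G' (e o) a) =
      (prodBernoulli q).real (⋃ a ∈ A, siteConn G o a) := by
    rw [← hmap, map_measureReal_apply (measurable_preimage_config _) (hmeas _)]
    congr 1; ext ω
    simp only [Set.mem_preimage, Set.mem_iUnion, exists_prop, Finset.mem_map_equiv]
    constructor
    · rintro ⟨a, ha, h'⟩
      refine ⟨e.symm a, ha, ?_⟩
      rw [← hiff ω o (e.symm a), Equiv.apply_symm_apply]; exact h'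
    · rintro ⟨a, ha, h'⟩
      exact ⟨e a, by simpa using ha, (hiff ω o a).2 h'⟩
  have h1 := h n G' q' (A.map e.toEmbedding) (e o) (e b) (by rwa [keyU]) (by
    intro a ha
    rw [Finset.mem_map_equiv] at ha
    have := hab (e.symm a) ha
    rwa [← key, Equiv.apply_symm_apply] at this)
  rwa [key] at h1

/-! ## Finitely supported vertex weights on a countable vertex type -/

/-- **Site Conjecture 3 for finitely supported vertex weights on a countable graph**: if `q` vanishes off the finite set
`S`, the `ε`–`δ` statement holds for `prodBernoulli q` with `A ⊆ S`, `o, b ∈ S` (restriction coupling to the induced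
finite graph on `S`, on whose vertices the configuration a.s. lives). [cite: KozmaNitzan2024, Conjecture 3 (p. 15)] -/
theorem siteGluing_finSupp {ε : ℝ} (hε : 0 < ε) :
    ∃ δ : ℝ, 0 < δ ∧ ∀ (V : Type) [Countable V] [DecidableEq V] (G : SimpleGraph V) (q : V → unitInterval)
      (S : Finset V), (∀ v ∉ S, q v = 0) →
      ∀ (A : Finset V) (o b : V), A ⊆ S → o ∈ S → b ∈ S →
      1 - δ < (prodBernoulli q).real (⋃ a ∈ A, siteConn G o a) →
        (∀ a ∈ A, 1 - δ < (prodBernoulli q).real (siteConn G a b)) →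
          1 - ε < (prodBernoulli q).real (siteConn G o b) := by
  obtain ⟨δ, hδ, h⟩ := siteGluing_fintype hε
  refine ⟨δ, hδ, fun V _ _ G q S hq A o b hAS ho hb hoA hab => ?_⟩
  classical
  set G' : SimpleGraph ↥S := G.comap (Subtype.val : ↥S → V) with hG'
  set q' : ↥S → unitInterval := fun x => q x with hq'
  set π : Set V → Set ↥S := fun ω => (Subtype.val : ↥S → V) ⁻¹' ω with hπ
  have hmap : (prodBernoulli q).map π = prodBernoulli q' := prodBernoulli_map_preimage q Subtype.val_injective
  have hmeas : ∀ C : Set (Set ↥S), MeasurableSet C := fun _ => MeasurableSet.of_discrete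
  -- a.s. every open vertex lies in `S`
  have hae : ∀ᵐ ω ∂prodBernoulli q, ∀ v, v ∈ ω → v ∈ S := by
    have hZ : ((↑S : Set V)ᶜ).Countable := Set.to_countable _
    filter_upwards [prodBernoulli_ae_forall_notMem q hZ fun v hv => hq v hv] with ω hω v hv
    by_contra hvS
    exact hω v hvS hv
  -- transport of connections, for configurations inside `S`
  have hiff : ∀ (ω : Set V), (∀ v, v ∈ ω → v ∈ S) → ∀ (x y : V) (hx : x ∈ S) (hy : y ∈ S),
      π ω ∈ siteConn G' ⟨x, hx⟩ ⟨y, hy⟩ ↔ ω ∈ siteConn G x y := by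
    intro ω hω x y hx hy
    let ψ : siteOpenGraph G' (π ω) →g siteOpenGraph G ω :=
      { toFun := Subtype.val
        map_rel' := fun {a c} hac => by
          rw [siteOpenGraph_adj] at hac ⊢
          simp only [hG', SimpleGraph.comap_adj, hπ, Set.mem_preimage] at hac
          exact hac }
    constructor
    · rintro ⟨hx', hy', hr⟩
      exact ⟨hx', hy', by simpa [ψ] using hr.map ψ⟩
    · rintro ⟨hxω, hyω, ⟨p⟩⟩
      refine ⟨hxω, hyω, ?_⟩
      -- lift the walk vertex by vertex
      suffices H : ∀ {a b : V} (_ : (siteOpenGraph G ω).Walk a b) (ha : a ∈ S) (hb : b ∈ S),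
          (siteOpenGraph G' (π ω)).Reachable ⟨a, ha⟩ ⟨b, hb⟩ from H p hx hy
      intro a b p
      induction p with
      | nil => intro ha _; exact SimpleGraph.Reachable.refl _
      | @cons a c _ hac p' ih =>
        intro ha hb
        obtain ⟨hadj, haω, hcω⟩ := (siteOpenGraph_adj G ω a c).1 hac
        have hc : c ∈ S := hω c hcω
        refine SimpleGraph.Reachable.trans (SimpleGraph.Adj.reachable ?_) (ih hc hb)
        rw [siteOpenGraph_adj]
        simp only [hG', SimpleGraph.comap_adj, hπ, Set.mem_preimage]
        exact ⟨hadj, haω, hcω⟩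
  have key : ∀ (x y : V) (hx : x ∈ S) (hy : y ∈ S),
      (prodBernoulli q').real (siteConn G' ⟨x, hx⟩ ⟨y, hy⟩) = (prodBernoulli q).real (siteConn G x y) := by
    intro x y hx hy
    rw [← hmap, map_measureReal_apply (measurable_preimage_config _) (hmeas _)]
    refine measureReal_congr ?_
    filter_upwards [hae] with ω hω
    exact propext (hiff ω hω x y hx hy)
  set A' : Finset ↥S := A.subtype (· ∈ S) with hA'
  have keyU : (prodBernoulli q').real (⋃ a ∈ A', siteConn G' ⟨o, ho⟩ a) =
      (prodBernoulli q).real (⋃ a ∈ A, siteConn G o a) := by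
    rw [← hmap, map_measureReal_apply (measurable_preimage_config _) (hmeas _)]
    refine measureReal_congr ?_
    filter_upwards [hae] with ω hω
    change (ω ∈ π ⁻¹' (⋃ a ∈ A', siteConn G' ⟨o, ho⟩ a)) = (ω ∈ ⋃ a ∈ A, siteConn G o a)
    simp only [Set.mem_preimage, Set.mem_iUnion, exists_prop, hA', Finset.mem_subtype, eq_iff_iff]
    constructor
    · rintro ⟨a, ha, h'⟩
      exact ⟨a, ha, (hiff ω hω o a ho a.2).1 h'⟩
    · rintro ⟨a, ha, h'⟩
      exact ⟨⟨a, hAS ha⟩, ha, (hiff ω hω o a ho (hAS ha)).2 h'⟩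
  have h1 := h ↥S G' q' A' ⟨o, ho⟩ ⟨b, hb⟩ (by rwa [keyU]) (by
    intro a ha
    rw [hA', Finset.mem_subtype] at ha
    have := hab a ha
    rwa [← key a b a.2 hb] at this)
  rwa [key] at h1

/-! ## A target SET (via the apex graph of `SiteKNTools`) -/

/-- **Site Conjecture 3 with a target SET**: for finitely supported vertex weights on a countable graph, if
`P(o ↔ A) > 1 − δ` and `P(a ↔ T) > 1 − δ` for all `a ∈ A` then `P(o ↔ T) > 1 − ε`.  Proof: `siteGluing_finSupp` in the
apex graph over `T` with the apex of weight `1` as the target vertex `b`. [cite: KozmaNitzan2024, §4 p. 22 and Conjecture 3 (p. 15)] -/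
theorem siteGluing_set {ε : ℝ} (hε : 0 < ε) :
    ∃ δ : ℝ, 0 < δ ∧ ∀ (V : Type) [Countable V] [DecidableEq V] (G : SimpleGraph V) (q : V → unitInterval)
      (S : Finset V), (∀ v ∉ S, q v = 0) →
      ∀ (A T : Finset V) (o : V), A ⊆ S → T ⊆ S → o ∈ S → T.Nonempty →
        1 - δ < (prodBernoulli q).real (⋃ a ∈ A, siteConn G o a) →
          (∀ a ∈ A, 1 - δ < (prodBernoulli q).real (⋃ t ∈ T, siteConn G a t)) →
            1 - ε < (prodBernoulli q).real (⋃ t ∈ T, siteConn G o t) := by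
  obtain ⟨δ, hδ, h⟩ := siteGluing_finSupp hε
  refine ⟨δ, hδ, fun V _ _ G q S hq A T o hAS hTS ho _ hoA haT => ?_⟩
  classical
  set G' := apexGraph G (↑T : Set V) with hG'
  set q' : Option V → unitInterval := fun x => x.elim 1 q with hq'
  set π : Set (Option V) → Set V := fun ω => some ⁻¹' ω with hπ
  have hmap : (prodBernoulli q').map π = prodBernoulli q := prodBernoulli_map_preimage q' (Option.some_injective V)
  have hq'S : ∀ x ∉ Finset.insertNone S, q' x = 0 := by
    intro x hx
    rcases x with _ | v
    · exact absurd Finset.none_mem_insertNone hx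
    · exact hq v fun hv => hx (Finset.some_mem_insertNone.2 hv)
  have hnone : ∀ᵐ ω ∂prodBernoulli q', (none : Option V) ∈ ω := prodBernoulli_ae_mem_of_eq_one q' rfl
  -- pulled-back probabilities
  have pull : ∀ {E : Set (Set V)}, MeasurableSet E → (prodBernoulli q).real E = (prodBernoulli q').real (π ⁻¹' E) :=
    fun hE => by rw [← hmap, map_measureReal_apply (measurable_preimage_config _) hE]
  -- lifting connections of `G` to the old vertices of `G'`
  have lift : ∀ (ω : Set (Option V)) (x y : V), π ω ∈ siteConn G x y → ω ∈ siteConn G' (some x) (some y) := by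
    intro ω x y hxy
    let φ : G →g G' := { toFun := some, map_rel' := fun hab => (apexGraph_adj_some_some G _ _ _).2 hab }
    exact siteConn_map φ (fun v hv => hv) hxy
  -- (i) the source hypothesis
  have hoA' : 1 - δ < (prodBernoulli q').real (⋃ a ∈ A.map Function.Embedding.some, siteConn G' (some o) a) := by
    refine (hoA.trans_le ?_)
    rw [pull (measurableSet_biUnion_siteConn G o A)]
    refine measureReal_mono ?_ (measure_ne_top _ _)
    intro ω hω
    simp only [Set.mem_preimage, Set.mem_iUnion, exists_prop, Finset.mem_map, Function.Embedding.some_apply] at hω ⊢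
    obtain ⟨a, ha, h'⟩ := hω
    exact ⟨some a, ⟨a, ha, rfl⟩, lift ω o a h'⟩
  -- (ii) the relays reach the apex
  have haT' : ∀ a ∈ A.map Function.Embedding.some, 1 - δ < (prodBernoulli q').real (siteConn G' a none) := by
    intro a' ha'
    rw [Finset.mem_map] at ha'
    obtain ⟨a, ha, rfl⟩ := ha'
    refine (haT a ha).trans_le ?_
    rw [pull (Finset.measurableSet_biUnion _ fun t _ => measurableSet_siteConn G a t)]
    have hle : (prodBernoulli q').real (π ⁻¹' ⋃ t ∈ T, siteConn G a t) =
        (prodBernoulli q').real ((π ⁻¹' ⋃ t ∈ T, siteConn G a t) ∩ {ω | (none : Option V) ∈ ω}) := by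
      refine measureReal_congr ?_
      filter_upwards [hnone] with ω hω
      exact propext ⟨fun h' => ⟨h', hω⟩, fun h' => h'.1⟩
    rw [hle]
    refine measureReal_mono ?_ (measure_ne_top _ _)
    rintro ω ⟨hω, hn⟩
    simp only [Set.mem_preimage, Set.mem_iUnion, exists_prop] at hω
    obtain ⟨t, ht, h'⟩ := hω
    obtain ⟨ha1, ht1, hr⟩ := lift ω a t h'
    refine ⟨ha1, hn, hr.trans (SimpleGraph.Adj.reachable ?_)⟩
    rw [siteOpenGraph_adj]
    exact ⟨(apexGraph_adj_some_none G _ t).2 (Finset.mem_coe.2 ht), ht1, hn⟩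
  -- (iii) apply and project back
  have h1 := h (Option V) G' q' (Finset.insertNone S) hq'S (A.map Function.Embedding.some) (some o) none
    (fun a ha => by
      rw [Finset.mem_map] at ha
      obtain ⟨a, ha, rfl⟩ := ha
      exact Finset.some_mem_insertNone.2 (hAS ha))
    (Finset.some_mem_insertNone.2 ho) Finset.none_mem_insertNone hoA' haT'
  refine h1.trans_le ?_
  rw [pull (Finset.measurableSet_biUnion _ fun t _ => measurableSet_siteConn G o t)]
  refine measureReal_mono ?_ (measure_ne_top _ _)
  rintro ω ⟨_, _, ⟨p⟩⟩
  obtain ⟨t, ht, hconn⟩ := exists_siteConn_of_walk_apex G (↑T : Set V) ω p o rfl rfl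
  simp only [Set.mem_preimage, Set.mem_iUnion, exists_prop]
  exact ⟨t, Finset.mem_coe.1 ht, hconn⟩

/-- **The AVOIDING form** (the hypothesis `hC` of the site target lemma, site twin of the `hC` of
`KozmaNitzan.targetLemma_avoiding`): relays only assumed reliable to `T` INSIDE a region `Rg` (`siteConnIn G Rg a t`);
implied by `siteGluing_set` by monotonicity (`Rg ∌ o` is not used). [cite: KozmaNitzan2024, §4 p. 22; p. 36 (Question 9)] -/
theorem siteGluing_avoiding {ε : ℝ} (hε : 0 < ε) :
    ∃ δ : ℝ, 0 < δ ∧ ∀ (V : Type) [Countable V] [DecidableEq V] (G : SimpleGraph V) (q : V → unitInterval)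
      (S : Finset V), (∀ v ∉ S, q v = 0) →
      ∀ (A T : Finset V) (o : V) (Rg : Set V), A ⊆ S → T ⊆ S → o ∈ S → T.Nonempty → o ∉ Rg →
        1 - δ < (prodBernoulli q).real (⋃ a ∈ A, siteConn G o a) →
          (∀ a ∈ A, 1 - δ < (prodBernoulli q).real (⋃ t ∈ T, siteConnIn G Rg a t)) →
            1 - ε < (prodBernoulli q).real (⋃ t ∈ T, siteConn G o t) := by
  obtain ⟨δ, hδ, h⟩ := siteGluing_set hε
  refine ⟨δ, hδ, fun V _ _ G q S hq A T o Rg hAS hTS ho hne _ hoA haT => h V G q S hq A T o hAS hTS ho hne hoA ?_⟩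
  intro a ha
  refine (haT a ha).trans_le (measureReal_mono (Set.iUnion₂_mono fun t _ => ?_) (measure_ne_top _ _))
  exact siteConnIn_subset_siteConn G Rg a t
end SiteKN

end Summit.CriticalPhenomena.PercolationContinuityZ3.Theorems.Transplant

end
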